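import Literature.MathematicalPhysics.QuantumLattice.SpinPartialTrace
import Literature.Computability.QuantumComplexity.QuantumMarginals
import Mathlib.LinearAlgebra.Matrix.Kronecker
import HarnessLib

/-!
# Bipartite partial traces versus Kronecker products: duality, positivity, the intertwining of
# coarse-graining with partial traces, and the bridge to the spin-system partial trace

Family `hubbard` (topic `MathematicalPhysics/QuantumLattice`; Part 2 of the partial-trace API of
`SpinPartialTrace`, serving the sr-mbsolver lane-B "theorem B" = soundness of the COARSE-GRAINED LTI
relaxation of Kull–Schuch–Dive–Navascués, and the entropy-constraint facts filed over product-indexed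
density matrices). The tree has two partial-trace vocabularies: the bipartite `traceLeft`/`traceRight` of
`Literature.Computability.QuantumComplexity` (QuantumMarginals; matrices on a product index `m × n`, where
Mathlib's Kronecker product `⊗ₖ` lives) and the spin-system `spinPartialTrace φ` along a site injection
(SpinPartialTrace; matrices on configurations `Λ → Fin q`). This file supplies, for the bipartite one, what
the coarse-graining step of KSDN needs, and identifies the two:

* duality with the ampliations written as Kronecker products, `tr (S · tr_B ρ) = tr ((S ⊗ₖ 𝟙) ρ)`,
  `tr (S · tr_A ρ) = tr ((𝟙 ⊗ₖ S) ρ)`, and uniqueness (Nielsen–Chuang Box 2.6);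
* linearity, `*`-compatibility, `tr_B (A ⊗ₖ B) = tr(B) · A`, `tr_A (A ⊗ₖ B) = tr(A) · B`, preservation of
  positive semidefiniteness and of density matrices (`posSemidef_traceLeft/Right`, `isDensity_traceLeft/Right`);
* **the intertwining relation** (KSDN §3.2 eq. (intertwineB), their Example 1 "the partial trace and the
  coarse-graining map act on different sites"): `tr_A ((L ⊗ M) X (L ⊗ M)ᴴ) = M (tr_A X) Mᴴ` for an isometry
  `L` on the traced factor and ANY (rectangular, e.g. an MPS coarse-graining) `M` on the kept factor, and
  symmetrically for `tr_B`; in particular an isometric compression of the traced factor is invisible and a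
  compression of the kept factor commutes with the trace
  (`traceLeft/Right_kronecker_mul_mul_conjTranspose`, `…_one_kronecker_…`, `…_of_isometry`);
* three tensor factors `a × (b × c)` (KSDN's variables `ω_{1,o_m,m}` on `ℂ^d ⊗ ℂ^{D²} ⊗ ℂ^d`): tracing out the
  first factor is `traceLeft`, tracing out the last is `traceRight` after `Equiv.prodAssoc`; coarse-graining
  the MIDDLE factor by `𝟙 ⊗ V ⊗ 𝟙` commutes with both (`traceLeft_middle_conj`,
  `traceRight_prodAssoc_middle_conj`);
* **the bridge**: for a window of `n+1` sites, `tr_L = spinPartialTrace (Fin.succEmb n)` IS `traceLeft` after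
  the split `Fin.consEquiv` (first site, rest) and `tr_R = spinPartialTrace Fin.castSuccEmb` IS `traceRight`
  after the split (rest, last site); for `n+2` sites the three-way split `windowSplit3` (first, middle `n`, last)
  turns them into the `a × (b × c)` forms above (`spinPartialTrace_succEmb_eq_traceLeft`,
  `spinPartialTrace_castSuccEmb_eq_traceRight`, `…_windowSplit3`). So the window marginals of a
  translation-invariant ring state (density matrices `densityAlong`/`spinPartialTrace` of SpinPartialTrace,
  PSD, trace one, LTI) drop into the product-indexed world in which the MPS maps `V`, `L`, `R` of the
  coarse-grained relaxation act by Kronecker sandwiches.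

* small windows with literal site legs (`pairConfig : Fin q × Fin q ≃ TensorIndex (Fin 2) q`,
  `tripleConfig : Fin q × (Fin q × Fin q) ≃ TensorIndex (Fin 3) q`, `(a,(b,c)) ↦ ![a,b,c]`): `traceLeft`/`traceRight` of
  `ρ^{(3)}` in these coordinates are `tr_L`/`tr_R` in the coordinates `pairConfig`, so the LTI row of the relaxation
  follows from the LTI equation (`traceLeft_submatrix_tripleConfig_eq_traceRight_of_lti`); coherence of the two- and
  three-way window splittings (`submatrix_windowSplit3_prodAssoc`).

Everything is PROVED; the only definitions are the bookkeeping equivalences `windowSplit3`, `pairConfig`,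
`tripleConfig` (with bodies).

## References
* M. A. Nielsen, I. L. Chuang, *Quantum Computation and Quantum Information* (10th anniversary ed., CUP 2010),
  §2.4.3, eqs. (2.177)–(2.182), Box 2.6 (partial trace, `tr(M ρ^A) = tr((M ⊗ I_B) ρ^{AB})`, uniqueness),
  pp. 105–107. [cite: NielsenChuang2010, §2.4.3]
* I. Kull, N. Schuch, B. Dive, M. Navascués, *Lower bounding ground-state energies of local Hamiltonians through
  the renormalization group*, Phys. Rev. X 14, 021008 (2024) = arXiv:2212.03014, §2.1–2.4 (LTI condition,
  coarse-graining `C(ρ) = (1 ⊗ W ⊗ 1) ρ (1 ⊗ W ⊗ 1)ᴴ`, compressed variables `ω_m`), §3.2 eq. (intertwineB) and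
  Example 1. [cite: KullEtAl2024, §3.2]
* O. Bratteli, D. W. Robinson, *Operator Algebras and Quantum Statistical Mechanics I*, 2nd ed. (Springer 1987),
  §2.3.2 (positivity of states). [cite: BratteliRobinsonI1987, §2.3.2]

## Mathlib / tree
Used: `Matrix.kroneckerMap` / `⊗ₖ` (`mul_kronecker_mul`, `conjTranspose_kronecker`, `kronecker_apply`),
`Matrix.submatrix_mul_equiv`, `Matrix.posSemidef_submatrix_equiv`, `Matrix.PosSemidef.mul_mul_conjTranspose_same`,
`Fin.consEquiv`/`Fin.snocEquiv`/`Fin.cons_snoc_eq_snoc_cons`; tree: QuantumMarginals (`traceLeft`, `traceRight`,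
`trace_mul_traceRight`, `trace_traceLeft/Right`, `IsDensity`), SpinPartialTrace (`trace_single_mul`,
`spinPartialTrace_succEmb_apply`, `spinPartialTrace_castSuccEmb_apply`).
-/

noncomputable section

namespace Literature.MathematicalPhysics.QuantumLattice

open Matrix Finset Literature.Computability.QuantumComplexity
open scoped ComplexOrder BigOperators Kronecker

section Bipartite

variable {m n m' n' : Type*}

/-! #### Duality with the ampliations `S ⊗ₖ 1`, `1 ⊗ₖ S`, and uniqueness -/

/-- **`tr (S · tr_B ρ) = tr ((S ⊗ 𝟙_B) ρ)`** — the defining property of the partial trace over the second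
factor, with the ampliation written as a Kronecker product. [cite: NielsenChuang2010, §2.4.3 Box 2.6 eq. (2.180)] -/
theorem trace_mul_traceRight_eq_kronecker [Fintype m] [Fintype n] [DecidableEq n] (S : Matrix m m ℂ) (ρ : Matrix (m × n) (m × n) ℂ) :
    (S * traceRight ρ).trace = (S ⊗ₖ (1 : Matrix n n ℂ) * ρ).trace := by
  rw [trace_mul_traceRight]
  congr 2
  ext p q
  simp only [Matrix.of_apply, Matrix.kroneckerMap_apply, Matrix.one_apply, mul_ite, mul_one, mul_zero]

/-- **`tr (S · tr_A ρ) = tr ((𝟙_A ⊗ S) ρ)`** — the defining property of the partial trace over the first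
factor. [cite: NielsenChuang2010, §2.4.3 Box 2.6 eq. (2.180)] -/
theorem trace_mul_traceLeft_eq_kronecker [Fintype m] [DecidableEq m] [Fintype n] (S : Matrix n n ℂ) (ρ : Matrix (m × n) (m × n) ℂ) :
    (S * traceLeft ρ).trace = ((1 : Matrix m m ℂ) ⊗ₖ S * ρ).trace := by
  simp only [Matrix.trace, Matrix.diag_apply, Matrix.mul_apply, traceLeft_apply, Matrix.kroneckerMap_apply,
    Matrix.one_apply, Fintype.sum_prod_type, ite_mul, one_mul, zero_mul, Finset.sum_ite_irrel,
    Finset.sum_const_zero, Finset.sum_ite_eq, Finset.mem_univ, if_true, Finset.mul_sum]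
  -- LHS: `∑ b, ∑ b', ∑ a, S b b' * ρ (a, b') (a, b)`; RHS: `∑ a, ∑ b, ∑ b', S b b' * ρ (a, b') (a, b)`
  conv_rhs => rw [Finset.sum_comm]
  exact Finset.sum_congr rfl fun b _ => Finset.sum_comm

/-- **Uniqueness of `tr_B`**: an operator reproducing all the expectations `tr (S R) = tr ((S ⊗ 𝟙) ρ)`
is the partial trace. [cite: NielsenChuang2010, §2.4.3 Box 2.6 eqs. (2.181)–(2.182)] -/
theorem eq_traceRight_of_forall_trace_mul [Fintype m] [DecidableEq m] [Fintype n] [DecidableEq n] (ρ : Matrix (m × n) (m × n) ℂ) {R : Matrix m m ℂ}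
    (h : ∀ S : Matrix m m ℂ, (S * R).trace = (S ⊗ₖ (1 : Matrix n n ℂ) * ρ).trace) : R = traceRight ρ := by
  ext i j
  have h1 := h (Matrix.single j i 1)
  rw [← trace_mul_traceRight_eq_kronecker, trace_single_mul, trace_single_mul, one_mul, one_mul] at h1
  exact h1

/-- **Uniqueness of `tr_A`**. [cite: NielsenChuang2010, §2.4.3 Box 2.6 eqs. (2.181)–(2.182)] -/
theorem eq_traceLeft_of_forall_trace_mul [Fintype m] [DecidableEq m] [Fintype n] [DecidableEq n] (ρ : Matrix (m × n) (m × n) ℂ) {R : Matrix n n ℂ}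
    (h : ∀ S : Matrix n n ℂ, (S * R).trace = ((1 : Matrix m m ℂ) ⊗ₖ S * ρ).trace) : R = traceLeft ρ := by
  ext i j
  have h1 := h (Matrix.single j i 1)
  rw [← trace_mul_traceLeft_eq_kronecker, trace_single_mul, trace_single_mul, one_mul, one_mul] at h1
  exact h1

/-! #### Linearity, `*`-compatibility, Kronecker products -/

/-- `tr_B (ρ + σ) = tr_B ρ + tr_B σ`. [cite: NielsenChuang2010, §2.4.3] -/
theorem traceRight_add [Fintype n] (ρ σ : Matrix (m × n) (m × n) ℂ) : traceRight (ρ + σ) = traceRight ρ + traceRight σ := by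
  ext; simp [Finset.sum_add_distrib]

/-- `tr_A (ρ + σ) = tr_A ρ + tr_A σ`. [cite: NielsenChuang2010, §2.4.3] -/
theorem traceLeft_add [Fintype m] (ρ σ : Matrix (m × n) (m × n) ℂ) : traceLeft (ρ + σ) = traceLeft ρ + traceLeft σ := by
  ext; simp [Finset.sum_add_distrib]

/-- `tr_B (c • ρ) = c • tr_B ρ`. [cite: NielsenChuang2010, §2.4.3] -/
theorem traceRight_smul [Fintype n] (c : ℂ) (ρ : Matrix (m × n) (m × n) ℂ) : traceRight (c • ρ) = c • traceRight ρ := by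
  ext; simp [Finset.mul_sum]

/-- `tr_A (c • ρ) = c • tr_A ρ`. [cite: NielsenChuang2010, §2.4.3] -/
theorem traceLeft_smul [Fintype m] (c : ℂ) (ρ : Matrix (m × n) (m × n) ℂ) : traceLeft (c • ρ) = c • traceLeft ρ := by
  ext; simp [Finset.mul_sum]

/-- `tr_B (ρ - σ) = tr_B ρ - tr_B σ`. [cite: NielsenChuang2010, §2.4.3] -/
theorem traceRight_sub [Fintype n] (ρ σ : Matrix (m × n) (m × n) ℂ) : traceRight (ρ - σ) = traceRight ρ - traceRight σ := by
  ext; simp [Finset.sum_sub_distrib]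

/-- `tr_A (ρ - σ) = tr_A ρ - tr_A σ`. [cite: NielsenChuang2010, §2.4.3] -/
theorem traceLeft_sub [Fintype m] (ρ σ : Matrix (m × n) (m × n) ℂ) : traceLeft (ρ - σ) = traceLeft ρ - traceLeft σ := by
  ext; simp [Finset.sum_sub_distrib]

/-- `(tr_B ρ)ᴴ = tr_B (ρᴴ)`. [cite: NielsenChuang2010, §2.4.3] -/
theorem conjTranspose_traceRight [Fintype n] (ρ : Matrix (m × n) (m × n) ℂ) : (traceRight ρ)ᴴ = traceRight ρᴴ := by
  ext; simp [Matrix.conjTranspose_apply, star_sum]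

/-- `(tr_A ρ)ᴴ = tr_A (ρᴴ)`. [cite: NielsenChuang2010, §2.4.3] -/
theorem conjTranspose_traceLeft [Fintype m] (ρ : Matrix (m × n) (m × n) ℂ) : (traceLeft ρ)ᴴ = traceLeft ρᴴ := by
  ext; simp [Matrix.conjTranspose_apply, star_sum]

/-- **`tr_B (A ⊗ B) = tr(B) · A`** (Nielsen–Chuang eq. (2.178) summed). [cite: NielsenChuang2010, §2.4.3 eq. (2.178)] -/
theorem traceRight_kronecker [Fintype n] (A : Matrix m m ℂ) (B : Matrix n n ℂ) : traceRight (A ⊗ₖ B) = B.trace • A := by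
  ext i j
  simp only [traceRight_apply, Matrix.kroneckerMap_apply, Matrix.smul_apply, smul_eq_mul, Matrix.trace,
    Matrix.diag_apply]
  rw [Finset.sum_mul]
  exact Finset.sum_congr rfl fun x _ => mul_comm _ _

/-- **`tr_A (A ⊗ B) = tr(A) · B`**. [cite: NielsenChuang2010, §2.4.3 eq. (2.178)] -/
theorem traceLeft_kronecker [Fintype m] (A : Matrix m m ℂ) (B : Matrix n n ℂ) : traceLeft (A ⊗ₖ B) = A.trace • B := by
  ext i j
  simp only [traceLeft_apply, Matrix.kroneckerMap_apply, Matrix.smul_apply, smul_eq_mul, Matrix.trace,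
    Matrix.diag_apply]
  rw [Finset.sum_mul]

/-! #### Positivity -/

/-- Positivity of the tracial pairing: `0 ≤ tr (Bᴴ B σ)` for `σ ⪰ 0`. [cite: BratteliRobinsonI1987, §2.3.2] -/
theorem trace_conjTranspose_mul_self_mul_nonneg' {ι κ : Type*} [Fintype ι] [Fintype κ] {σ : Matrix ι ι ℂ}
    (hσ : σ.PosSemidef) (B : Matrix κ ι ℂ) : 0 ≤ (Bᴴ * B * σ).trace := by
  rw [← Matrix.trace_mul_cycle B σ Bᴴ]
  exact (hσ.mul_mul_conjTranspose_same B).trace_nonneg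

/-- The rank-one form `|x⟩⟨x|` is `Bᴴ B` with `B = |u⟩⟨x|`. [folklore] -/
private theorem vecMulVec_star_eq_conjTranspose_mul' {ι : Type*} [Fintype ι] [DecidableEq ι] (u : ι)
    (x : ι → ℂ) :
    Matrix.vecMulVec x (star x) =
      (Matrix.vecMulVec (Pi.single u 1 : ι → ℂ) (star x))ᴴ * Matrix.vecMulVec (Pi.single u 1 : ι → ℂ) (star x) := by
  have hs : star (Pi.single u 1 : ι → ℂ) = Pi.single u 1 := by
    ext j; by_cases h : j = u <;> simp [h]
  rw [Matrix.conjTranspose_vecMulVec, star_star, hs, Matrix.vecMulVec_mul_vecMulVec, single_dotProduct,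
    one_mul, Pi.single_eq_same, one_smul]

/-- **`tr_B` preserves positive semidefiniteness**: `ρ ⪰ 0 → tr_B ρ ⪰ 0`
(`xᴴ (tr_B ρ) x = tr ((|x⟩⟨x| ⊗ 𝟙) ρ) = tr ((B ⊗ 𝟙)ᴴ (B ⊗ 𝟙) ρ) ≥ 0`). [cite: NielsenChuang2010, §2.4.3] -/
theorem posSemidef_traceRight [Fintype m] [DecidableEq m] [Fintype n] [DecidableEq n] {ρ : Matrix (m × n) (m × n) ℂ} (hρ : ρ.PosSemidef) : (traceRight ρ).PosSemidef := by
  refine Matrix.PosSemidef.of_dotProduct_mulVec_nonneg ?_ fun x => ?_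
  · rw [Matrix.IsHermitian, conjTranspose_traceRight, hρ.isHermitian.eq]
  have h1 : star x ⬝ᵥ (traceRight ρ *ᵥ x) = (Matrix.vecMulVec x (star x) * traceRight ρ).trace := by
    rw [Matrix.trace_mul_comm, Matrix.mul_vecMulVec, Matrix.trace_vecMulVec, dotProduct_comm]
  rw [h1, trace_mul_traceRight_eq_kronecker]
  rcases isEmpty_or_nonempty m with hE | ⟨⟨u⟩⟩
  · have h0 : Matrix.vecMulVec x (star x) = 0 := by ext i; exact isEmptyElim i
    simp [h0]
  · rw [vecMulVec_star_eq_conjTranspose_mul' u x, ← Matrix.one_mul (1 : Matrix n n ℂ),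
      Matrix.mul_kronecker_mul, ← Matrix.conjTranspose_one (n := n), ← Matrix.conjTranspose_kronecker,
      Matrix.conjTranspose_one]
    exact trace_conjTranspose_mul_self_mul_nonneg' hρ _

/-- **`tr_A` preserves positive semidefiniteness**. [cite: NielsenChuang2010, §2.4.3] -/
theorem posSemidef_traceLeft [Fintype m] [DecidableEq m] [Fintype n] [DecidableEq n] {ρ : Matrix (m × n) (m × n) ℂ} (hρ : ρ.PosSemidef) : (traceLeft ρ).PosSemidef := by
  refine Matrix.PosSemidef.of_dotProduct_mulVec_nonneg ?_ fun x => ?_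
  · rw [Matrix.IsHermitian, conjTranspose_traceLeft, hρ.isHermitian.eq]
  have h1 : star x ⬝ᵥ (traceLeft ρ *ᵥ x) = (Matrix.vecMulVec x (star x) * traceLeft ρ).trace := by
    rw [Matrix.trace_mul_comm, Matrix.mul_vecMulVec, Matrix.trace_vecMulVec, dotProduct_comm]
  rw [h1, trace_mul_traceLeft_eq_kronecker]
  rcases isEmpty_or_nonempty n with hE | ⟨⟨u⟩⟩
  · have h0 : Matrix.vecMulVec x (star x) = 0 := by ext i; exact isEmptyElim i
    simp [h0]
  · rw [vecMulVec_star_eq_conjTranspose_mul' u x, ← Matrix.one_mul (1 : Matrix m m ℂ),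
      Matrix.mul_kronecker_mul, ← Matrix.conjTranspose_one (n := m), ← Matrix.conjTranspose_kronecker,
      Matrix.conjTranspose_one]
    exact trace_conjTranspose_mul_self_mul_nonneg' hρ _

/-- Density matrices have density-matrix marginals (`tr_B`). [cite: NielsenChuang2010, §2.4.3] -/
theorem isDensity_traceRight [Fintype m] [DecidableEq m] [Fintype n] [DecidableEq n] {ρ : Matrix (m × n) (m × n) ℂ} (hρ : IsDensity ρ) : IsDensity (traceRight ρ) :=
  ⟨posSemidef_traceRight hρ.1, by rw [trace_traceRight, hρ.2]⟩

/-- Density matrices have density-matrix marginals (`tr_A`). [cite: NielsenChuang2010, §2.4.3] -/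
theorem isDensity_traceLeft [Fintype m] [DecidableEq m] [Fintype n] [DecidableEq n] {ρ : Matrix (m × n) (m × n) ℂ} (hρ : IsDensity ρ) : IsDensity (traceLeft ρ) :=
  ⟨posSemidef_traceLeft hρ.1, by rw [trace_traceLeft, hρ.2]⟩

/-! #### Kronecker sandwiches: coarse-graining one factor commutes with tracing out the other -/

/-- **Intertwining (Kull–Schuch–Dive–Navascués eq. (intertwineB), Example 1: "the partial trace and the
coarse-graining act on different sites").** For `L` an isometry on the first factor (`Lᴴ L = 1`) and any
`M` on the second, `tr_A ((L ⊗ M) X (L ⊗ M)ᴴ) = M (tr_A X) Mᴴ`. [cite: KullEtAl2024, §3.2 eq. (intertwineB)] -/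
theorem traceLeft_kronecker_mul_mul_conjTranspose [Fintype m] [DecidableEq m] [Fintype n]
    [Fintype m'] [DecidableEq m'] [Fintype n'] [DecidableEq n'] (L : Matrix m' m ℂ) (M : Matrix n' n ℂ) (hL : Lᴴ * L = 1)
    (X : Matrix (m × n) (m × n) ℂ) :
    traceLeft (L ⊗ₖ M * X * (L ⊗ₖ M)ᴴ) = M * traceLeft X * Mᴴ := by
  symm
  refine eq_traceLeft_of_forall_trace_mul _ fun S => ?_
  have hk : (L ⊗ₖ M)ᴴ * ((1 : Matrix m' m' ℂ) ⊗ₖ S) * (L ⊗ₖ M) = (1 : Matrix m m ℂ) ⊗ₖ (Mᴴ * S * M) := by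
    rw [Matrix.conjTranspose_kronecker, ← Matrix.mul_kronecker_mul, ← Matrix.mul_kronecker_mul, Matrix.mul_one, hL]
  calc (S * (M * traceLeft X * Mᴴ)).trace = (Mᴴ * S * M * traceLeft X).trace := by
        rw [← Matrix.mul_assoc, ← Matrix.mul_assoc, Matrix.trace_mul_comm, ← Matrix.mul_assoc, ← Matrix.mul_assoc]
    _ = ((1 : Matrix m m ℂ) ⊗ₖ (Mᴴ * S * M) * X).trace := trace_mul_traceLeft_eq_kronecker _ _
    _ = ((L ⊗ₖ M)ᴴ * ((1 : Matrix m' m' ℂ) ⊗ₖ S) * (L ⊗ₖ M) * X).trace := by rw [hk]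
    _ = ((1 : Matrix m' m' ℂ) ⊗ₖ S * (L ⊗ₖ M * X * (L ⊗ₖ M)ᴴ)).trace := by
        rw [← Matrix.mul_assoc, ← Matrix.mul_assoc,
          Matrix.trace_mul_comm ((1 : Matrix m' m' ℂ) ⊗ₖ S * (L ⊗ₖ M) * X), ← Matrix.mul_assoc,
          ← Matrix.mul_assoc]

/-- **Intertwining, second factor**: for `M` an isometry on the second factor (`Mᴴ M = 1`) and any `L` on
the first, `tr_B ((L ⊗ M) X (L ⊗ M)ᴴ) = L (tr_B X) Lᴴ`. [cite: KullEtAl2024, §3.2 eq. (intertwineB)] -/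
theorem traceRight_kronecker_mul_mul_conjTranspose [Fintype m] [Fintype n] [DecidableEq n]
    [Fintype m'] [DecidableEq m'] [Fintype n'] [DecidableEq n'] (L : Matrix m' m ℂ) (M : Matrix n' n ℂ) (hM : Mᴴ * M = 1)
    (X : Matrix (m × n) (m × n) ℂ) :
    traceRight (L ⊗ₖ M * X * (L ⊗ₖ M)ᴴ) = L * traceRight X * Lᴴ := by
  symm
  refine eq_traceRight_of_forall_trace_mul _ fun S => ?_
  have hk : (L ⊗ₖ M)ᴴ * (S ⊗ₖ (1 : Matrix n' n' ℂ)) * (L ⊗ₖ M) = (Lᴴ * S * L) ⊗ₖ (1 : Matrix n n ℂ) := by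
    rw [Matrix.conjTranspose_kronecker, ← Matrix.mul_kronecker_mul, ← Matrix.mul_kronecker_mul, Matrix.mul_one, hM]
  calc (S * (L * traceRight X * Lᴴ)).trace = (Lᴴ * S * L * traceRight X).trace := by
        rw [← Matrix.mul_assoc, ← Matrix.mul_assoc, Matrix.trace_mul_comm, ← Matrix.mul_assoc, ← Matrix.mul_assoc]
    _ = ((Lᴴ * S * L) ⊗ₖ (1 : Matrix n n ℂ) * X).trace := trace_mul_traceRight_eq_kronecker _ _
    _ = ((L ⊗ₖ M)ᴴ * (S ⊗ₖ (1 : Matrix n' n' ℂ)) * (L ⊗ₖ M) * X).trace := by rw [hk]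
    _ = (S ⊗ₖ (1 : Matrix n' n' ℂ) * (L ⊗ₖ M * X * (L ⊗ₖ M)ᴴ)).trace := by
        rw [← Matrix.mul_assoc, ← Matrix.mul_assoc,
          Matrix.trace_mul_comm (S ⊗ₖ (1 : Matrix n' n' ℂ) * (L ⊗ₖ M) * X), ← Matrix.mul_assoc,
          ← Matrix.mul_assoc]

/-- Coarse-graining the SECOND factor by any `M` commutes with tracing out the first:
`tr_A ((𝟙 ⊗ M) X (𝟙 ⊗ M)ᴴ) = M (tr_A X) Mᴴ`. [cite: KullEtAl2024, §3.2 eq. (intertwineB)] -/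
theorem traceLeft_one_kronecker_mul_mul_conjTranspose [Fintype m] [DecidableEq m] [Fintype n]
    [Fintype n'] [DecidableEq n'] (M : Matrix n' n ℂ) (X : Matrix (m × n) (m × n) ℂ) :
    traceLeft ((1 : Matrix m m ℂ) ⊗ₖ M * X * ((1 : Matrix m m ℂ) ⊗ₖ M)ᴴ) = M * traceLeft X * Mᴴ :=
  traceLeft_kronecker_mul_mul_conjTranspose 1 M (by rw [Matrix.conjTranspose_one, Matrix.mul_one]) X

/-- Coarse-graining the FIRST factor by any `L` commutes with tracing out the second:
`tr_B ((L ⊗ 𝟙) X (L ⊗ 𝟙)ᴴ) = L (tr_B X) Lᴴ`. [cite: KullEtAl2024, §3.2 eq. (intertwineB)] -/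
theorem traceRight_kronecker_one_mul_mul_conjTranspose [Fintype m] [Fintype n] [DecidableEq n]
    [Fintype m'] [DecidableEq m'] (L : Matrix m' m ℂ) (X : Matrix (m × n) (m × n) ℂ) :
    traceRight (L ⊗ₖ (1 : Matrix n n ℂ) * X * (L ⊗ₖ (1 : Matrix n n ℂ))ᴴ) = L * traceRight X * Lᴴ :=
  traceRight_kronecker_mul_mul_conjTranspose L 1 (by rw [Matrix.conjTranspose_one, Matrix.mul_one]) X

/-- An ISOMETRIC compression of the traced-out factor is invisible: `Lᴴ L = 1 →
tr_A ((L ⊗ 𝟙) X (L ⊗ 𝟙)ᴴ) = tr_A X`. [cite: KullEtAl2024, §3.2] -/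
theorem traceLeft_kronecker_one_mul_mul_conjTranspose_of_isometry [Fintype m] [DecidableEq m] [Fintype n]
    [DecidableEq n] [Fintype m'] [DecidableEq m'] (L : Matrix m' m ℂ) (hL : Lᴴ * L = 1)
    (X : Matrix (m × n) (m × n) ℂ) :
    traceLeft (L ⊗ₖ (1 : Matrix n n ℂ) * X * (L ⊗ₖ (1 : Matrix n n ℂ))ᴴ) = traceLeft X := by
  rw [traceLeft_kronecker_mul_mul_conjTranspose L 1 hL X, Matrix.conjTranspose_one, Matrix.mul_one, Matrix.one_mul]

/-- `Mᴴ M = 1 → tr_B ((𝟙 ⊗ M) X (𝟙 ⊗ M)ᴴ) = tr_B X`. [cite: KullEtAl2024, §3.2] -/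
theorem traceRight_one_kronecker_mul_mul_conjTranspose_of_isometry [Fintype m] [DecidableEq m] [Fintype n]
    [DecidableEq n] [Fintype n'] [DecidableEq n'] (M : Matrix n' n ℂ) (hM : Mᴴ * M = 1)
    (X : Matrix (m × n) (m × n) ℂ) :
    traceRight ((1 : Matrix m m ℂ) ⊗ₖ M * X * ((1 : Matrix m m ℂ) ⊗ₖ M)ᴴ) = traceRight X := by
  rw [traceRight_kronecker_mul_mul_conjTranspose 1 M hM X, Matrix.conjTranspose_one, Matrix.mul_one, Matrix.one_mul]

/-- A Kronecker sandwich preserves positive semidefiniteness: the coarse-graining maps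
`ρ ↦ (L ⊗ M) ρ (L ⊗ M)ᴴ` are completely positive, so coarse-grained states are (unnormalised) states.
[cite: KullEtAl2024, §3.2 ("we require all coarse-graining maps to be completely positive")] -/
theorem posSemidef_kronecker_mul_mul_conjTranspose [Fintype m] [Fintype n] [Fintype m'] [Fintype n'] (L : Matrix m' m ℂ) (M : Matrix n' n ℂ)
    {X : Matrix (m × n) (m × n) ℂ} (hX : X.PosSemidef) : (L ⊗ₖ M * X * (L ⊗ₖ M)ᴴ).PosSemidef :=
  hX.mul_mul_conjTranspose_same _

end Bipartite


/-! ### Three tensor factors `a × (b × c)`: tracing out the first or the last factor, coarse-graining the middle -/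

section ThreeFactors

variable {a b b' c : Type*} [Fintype a] [DecidableEq a] [Fintype b] [Fintype b'] [DecidableEq b'] [Fintype c]
  [DecidableEq c]

omit [Fintype a] [DecidableEq a] [Fintype b] [DecidableEq c] in
/-- Entries of the partial trace over the LAST factor of `ℋ_a ⊗ ℋ_b ⊗ ℋ_c` (written as `tr_B` after
reassociating `a × (b × c) ≃ (a × b) × c`): `Σ_z X_{(x,(y,z)),(x',(y',z))}`. [cite: NielsenChuang2010, §2.4.3 eq. (2.178)] -/
theorem traceRight_submatrix_prodAssoc_apply (X : Matrix (a × (b × c)) (a × (b × c)) ℂ) (x x' : a) (y y' : b) :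
    traceRight (X.submatrix (Equiv.prodAssoc a b c) (Equiv.prodAssoc a b c)) (x, y) (x', y') =
      ∑ z : c, X (x, (y, z)) (x', (y', z)) := rfl

omit [DecidableEq a] [Fintype b] [Fintype c] [DecidableEq c] in
/-- Entries of the partial trace over the FIRST factor of `ℋ_a ⊗ ℋ_b ⊗ ℋ_c` (`tr_A` on `a × (b × c)`):
`Σ_x X_{(x,(y,z)),(x,(y',z'))}`. [cite: NielsenChuang2010, §2.4.3 eq. (2.178)] -/
theorem traceLeft_three_apply (X : Matrix (a × (b × c)) (a × (b × c)) ℂ) (y y' : b) (z z' : c) :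
    traceLeft X (y, z) (y', z') = ∑ x : a, X (x, (y, z)) (x, (y', z')) := rfl

omit [Fintype a] [Fintype b] [Fintype b'] [DecidableEq b'] [Fintype c] in
/-- Reassociation of the middle coarse-graining map: `(𝟙_a ⊗ (V ⊗ 𝟙_c))` on `a × (b × c)` is
`((𝟙_a ⊗ V) ⊗ 𝟙_c)` on `(a × b) × c` (Mathlib's `kronecker_assoc`, recorded for the coarse-graining map
`𝟙 ⊗ W ⊗ 𝟙` of the LTI relaxation). [cite: KullEtAl2024, §2.3 (`C_2(ρ) = (𝟙 ⊗ W_2 ⊗ 𝟙) ρ (𝟙 ⊗ W_2† ⊗ 𝟙)`)] -/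
theorem one_kronecker_kronecker_one_submatrix_prodAssoc (V : Matrix b' b ℂ) :
    ((1 : Matrix a a ℂ) ⊗ₖ (V ⊗ₖ (1 : Matrix c c ℂ))).submatrix (Equiv.prodAssoc a b' c) (Equiv.prodAssoc a b c) =
      ((1 : Matrix a a ℂ) ⊗ₖ V) ⊗ₖ (1 : Matrix c c ℂ) := by
  ext ⟨⟨x, y⟩, z⟩ ⟨⟨x', y'⟩, z'⟩
  simp [Matrix.kroneckerMap_apply, mul_assoc]

/-- **Coarse-graining the MIDDLE factor commutes with tracing out the LAST factor**:
`tr_c ((𝟙 ⊗ V ⊗ 𝟙) X (𝟙 ⊗ V ⊗ 𝟙)ᴴ) = (𝟙 ⊗ V) (tr_c X) (𝟙 ⊗ V)ᴴ` — the intertwining relation of the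
coarse-grained LTI relaxation for the constraint "trace out the rightmost spin"
(`ω_{1,o,m} := (1 ⊗ V ⊗ 1) ρ_m (…)ᴴ`). [cite: KullEtAl2024, §2.3–2.4 and §3.2 eq. (intertwineB)] -/
theorem traceRight_prodAssoc_middle_conj (V : Matrix b' b ℂ) (X : Matrix (a × (b × c)) (a × (b × c)) ℂ) :
    traceRight (((1 : Matrix a a ℂ) ⊗ₖ (V ⊗ₖ (1 : Matrix c c ℂ)) * X *
        ((1 : Matrix a a ℂ) ⊗ₖ (V ⊗ₖ (1 : Matrix c c ℂ)))ᴴ).submatrix (Equiv.prodAssoc a b' c) (Equiv.prodAssoc a b' c)) =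
      ((1 : Matrix a a ℂ) ⊗ₖ V) * traceRight (X.submatrix (Equiv.prodAssoc a b c) (Equiv.prodAssoc a b c)) *
        ((1 : Matrix a a ℂ) ⊗ₖ V)ᴴ := by
  rw [← Matrix.submatrix_mul_equiv _ _ _ (Equiv.prodAssoc a b c), ← Matrix.submatrix_mul_equiv _ _ _ (Equiv.prodAssoc a b c),
    one_kronecker_kronecker_one_submatrix_prodAssoc]
  have h : (((1 : Matrix a a ℂ) ⊗ₖ (V ⊗ₖ (1 : Matrix c c ℂ)))ᴴ).submatrix (Equiv.prodAssoc a b c) (Equiv.prodAssoc a b' c) =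
      (((1 : Matrix a a ℂ) ⊗ₖ V) ⊗ₖ (1 : Matrix c c ℂ))ᴴ := by
    rw [← one_kronecker_kronecker_one_submatrix_prodAssoc, Matrix.conjTranspose_submatrix]
  rw [h, traceRight_kronecker_one_mul_mul_conjTranspose]

/-- **Coarse-graining the MIDDLE factor commutes with tracing out the FIRST factor**:
`tr_a ((𝟙 ⊗ V ⊗ 𝟙) X (𝟙 ⊗ V ⊗ 𝟙)ᴴ) = (V ⊗ 𝟙) (tr_a X) (V ⊗ 𝟙)ᴴ` ("trace out the leftmost spin").
[cite: KullEtAl2024, §2.3–2.4 and §3.2 eq. (intertwineB)] -/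
theorem traceLeft_middle_conj (V : Matrix b' b ℂ) (X : Matrix (a × (b × c)) (a × (b × c)) ℂ) :
    traceLeft (((1 : Matrix a a ℂ) ⊗ₖ (V ⊗ₖ (1 : Matrix c c ℂ))) * X * ((1 : Matrix a a ℂ) ⊗ₖ (V ⊗ₖ (1 : Matrix c c ℂ)))ᴴ) =
      (V ⊗ₖ (1 : Matrix c c ℂ)) * traceLeft X * (V ⊗ₖ (1 : Matrix c c ℂ))ᴴ :=
  traceLeft_one_kronecker_mul_mul_conjTranspose _ X

end ThreeFactors

/-! ### Bridge: the spin-system partial traces `tr_L`, `tr_R` of a window as bipartite partial traces -/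

section Bridge

variable {q n : ℕ}

/-- Splitting an `(n+1)`-site configuration into (first site, the rest): `Fin.consEquiv`. Along it
**`tr_L = spinPartialTrace (Fin.succEmb n)` is the bipartite `tr_A`**. [cite: KullEtAl2024, §2.1 (the LTI condition)] -/
theorem spinPartialTrace_succEmb_eq_traceLeft (ρ : Op (Fin (n + 1)) q) :
    spinPartialTrace (Fin.succEmb n) ρ =
      traceLeft (ρ.submatrix (Fin.consEquiv fun _ => Fin q) (Fin.consEquiv fun _ => Fin q)) := by
  ext t s
  rw [spinPartialTrace_succEmb_apply, traceLeft_apply]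
  rfl

/-- Splitting an `(n+1)`-site configuration into (the first `n` sites, last site):
`(s, a) ↦ Fin.snoc s a`. Along it **`tr_R = spinPartialTrace Fin.castSuccEmb` is the bipartite `tr_B`**.
[cite: KullEtAl2024, §2.1 (the LTI condition)] -/
theorem spinPartialTrace_castSuccEmb_eq_traceRight (ρ : Op (Fin (n + 1)) q) :
    spinPartialTrace Fin.castSuccEmb ρ =
      traceRight (ρ.submatrix ((Equiv.prodComm _ _).trans (Fin.snocEquiv fun _ => Fin q))
        ((Equiv.prodComm _ _).trans (Fin.snocEquiv fun _ => Fin q))) := by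
  ext t s
  rw [spinPartialTrace_castSuccEmb_apply, traceRight_apply]
  rfl

/-- The three-way split of an `(n+2)`-site window configuration into (first site, middle `n` sites, last
site): `(x, (s, z)) ↦ Fin.cons x (Fin.snoc s z)`. [cite: KullEtAl2024, §2.3 (`ω_{1,o_m,m}`)] -/
def windowSplit3 (n q : ℕ) : Fin q × ((Fin n → Fin q) × Fin q) ≃ TensorIndex (Fin (n + 2)) q :=
  (Equiv.prodCongr (Equiv.refl (Fin q)) ((Equiv.prodComm _ _).trans (Fin.snocEquiv fun _ => Fin q))).trans
    (Fin.consEquiv fun _ => Fin q)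

/-- `windowSplit3 (x, s, z) = Fin.cons x (Fin.snoc s z)`. [cite: KullEtAl2024, §2.3 (`ω_{1,o_m,m}`)] -/
@[simp] theorem windowSplit3_apply (x : Fin q) (s : Fin n → Fin q) (z : Fin q) :
    windowSplit3 n q (x, (s, z)) = Fin.cons x (Fin.snoc s z) := rfl

/-- **`tr_L` of an `(n+2)`-window in three-factor form**: after splitting the remaining `n+1` sites as
(middle, last), `spinPartialTrace (Fin.succEmb (n+1)) ρ` is `tr_A` of `ρ` in the coordinates
`first × (middle × last)`. [cite: KullEtAl2024, §2.3] -/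
theorem spinPartialTrace_succEmb_submatrix_eq_traceLeft_windowSplit3 (ρ : Op (Fin (n + 2)) q) :
    (spinPartialTrace (Fin.succEmb (n + 1)) ρ).submatrix ((Equiv.prodComm _ _).trans (Fin.snocEquiv fun _ => Fin q))
        ((Equiv.prodComm _ _).trans (Fin.snocEquiv fun _ => Fin q)) =
      traceLeft (ρ.submatrix (windowSplit3 n q) (windowSplit3 n q)) := by
  ext ⟨t, z⟩ ⟨s, z'⟩
  rw [Matrix.submatrix_apply, spinPartialTrace_succEmb_apply, traceLeft_apply]
  rfl

/-- **`tr_R` of an `(n+2)`-window in three-factor form**: after splitting the remaining `n+1` sites as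
(first, middle), `spinPartialTrace Fin.castSuccEmb ρ` is `tr_B` of `ρ` reassociated to
`(first × middle) × last`. [cite: KullEtAl2024, §2.3] -/
theorem spinPartialTrace_castSuccEmb_submatrix_eq_traceRight_windowSplit3 (ρ : Op (Fin (n + 2)) q) :
    (spinPartialTrace Fin.castSuccEmb ρ).submatrix (Fin.consEquiv fun _ => Fin q) (Fin.consEquiv fun _ => Fin q) =
      traceRight ((ρ.submatrix (windowSplit3 n q) (windowSplit3 n q)).submatrix
        (Equiv.prodAssoc _ _ _) (Equiv.prodAssoc _ _ _)) := by
  ext ⟨x, t⟩ ⟨x', s⟩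
  rw [Matrix.submatrix_apply, spinPartialTrace_castSuccEmb_apply, traceRight_apply]
  have e1 : (Fin.consEquiv fun _ => Fin q) (x, t) = Fin.cons x t := rfl
  have e2 : (Fin.consEquiv fun _ => Fin q) (x', s) = Fin.cons x' s := rfl
  refine Finset.sum_congr rfl fun z _ => ?_
  rw [e1, e2]
  simp only [Matrix.submatrix_apply, Equiv.prodAssoc_apply, windowSplit3_apply, Fin.cons_snoc_eq_snoc_cons]

/-- Positive semidefiniteness is unchanged by the three-way reindexing of a window (Mathlib's
`posSemidef_submatrix_equiv`, recorded): `ρ.submatrix windowSplit3 windowSplit3 ⪰ 0 ↔ ρ ⪰ 0`.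
[cite: KullEtAl2024, §2.2 (`ρ^{(m)} ≥ 0`)] -/
theorem posSemidef_submatrix_windowSplit3_iff (ρ : Op (Fin (n + 2)) q) :
    (ρ.submatrix (windowSplit3 n q) (windowSplit3 n q)).PosSemidef ↔ ρ.PosSemidef :=
  Matrix.posSemidef_submatrix_equiv (windowSplit3 n q)

end Bridge


/-! ### Small windows with literal site legs: `Fin q × Fin q ≃ TensorIndex (Fin 2) q`,
`Fin q × (Fin q × Fin q) ≃ TensorIndex (Fin 3) q` (the variables `ρ^{(2)}`, `ρ^{(3)}` of the relaxation) -/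

section SmallWindows

variable {q n : ℕ}

/-- A pair of site states as a two-site configuration: `(a, b) ↦ ![a, b]` (Mathlib's `finTwoArrowEquiv`,
inverted). This is the index convention `ℂ^d ⊗ ℂ^d` for the two-body marginal `ρ^{(2)}` on which the energy
`tr(h ρ^{(2)})` is evaluated. [cite: KullEtAl2024, §2.1 eq. (energy)] -/
def pairConfig (q : ℕ) : Fin q × Fin q ≃ TensorIndex (Fin 2) q :=
  (finTwoArrowEquiv (Fin q)).symm

/-- `pairConfig q (a, b) = ![a, b]`. [cite: KullEtAl2024, §2.1] -/
@[simp] theorem pairConfig_apply (a b : Fin q) : pairConfig q (a, b) = ![a, b] := rfl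

/-- `pairConfig q (a, b) = Fin.cons a (fun _ => b)` (the form produced by `Fin.consEquiv`). [cite: KullEtAl2024, §2.1] -/
theorem pairConfig_apply_eq_cons (a b : Fin q) : pairConfig q (a, b) = Fin.cons a (fun _ : Fin 1 => b) := by
  funext i
  fin_cases i <;> rfl

/-- `pairConfig q (a, b) = Fin.snoc (fun _ => a) b` (the form produced by `Fin.snocEquiv`). [cite: KullEtAl2024, §2.1] -/
theorem pairConfig_apply_eq_snoc (a b : Fin q) : pairConfig q (a, b) = Fin.snoc (fun _ : Fin 1 => a) b := by
  funext i
  fin_cases i <;> rfl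

/-- A triple of site states as a three-site configuration, associated as `first × (second × third)`:
`(a, (b, c)) ↦ ![a, b, c]`. This is the index type `ℂ^d ⊗ (ℂ^d ⊗ ℂ^d)` of the three-body variable `ρ^{(3)}`
of the relaxation (its rows `tr_L`, `tr_R`, `(W₂ ⊗ 𝟙) ρ^{(3)} (W₂ ⊗ 𝟙)ᴴ`, `(𝟙 ⊗ W₂) ρ^{(3)} (𝟙 ⊗ W₂)ᴴ`).
[cite: KullEtAl2024, §2.3–2.4 (`ρ^{(3)}`, `ω_4`)] -/
def tripleConfig (q : ℕ) : Fin q × (Fin q × Fin q) ≃ TensorIndex (Fin 3) q :=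
  (Equiv.prodCongr (Equiv.refl (Fin q)) (pairConfig q)).trans (Fin.consEquiv fun _ => Fin q)

/-- `tripleConfig q (a, (b, c)) = ![a, b, c]`. [cite: KullEtAl2024, §2.3] -/
@[simp] theorem tripleConfig_apply (a b c : Fin q) : tripleConfig q (a, (b, c)) = ![a, b, c] := rfl

/-- `tripleConfig q (a, (b, c)) = Fin.cons a (pairConfig q (b, c))` (first site split off). [cite: KullEtAl2024, §2.3] -/
theorem tripleConfig_apply_eq_cons (a b c : Fin q) :
    tripleConfig q (a, (b, c)) = Fin.cons a (pairConfig q (b, c)) := rfl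

/-- `tripleConfig q (a, (b, c)) = Fin.snoc (pairConfig q (a, b)) c` (last site split off). [cite: KullEtAl2024, §2.3] -/
theorem tripleConfig_apply_eq_snoc (a b c : Fin q) :
    tripleConfig q (a, (b, c)) = Fin.snoc (pairConfig q (a, b)) c := by
  rw [tripleConfig_apply_eq_cons, pairConfig_apply_eq_snoc, Fin.cons_snoc_eq_snoc_cons, ← pairConfig_apply_eq_cons]

/-- **`tr_L ρ^{(3)}` with literal legs**: in the coordinates `tripleConfig`, the bipartite `traceLeft` (trace over the
first site) of a three-site operator is its `tr_L = spinPartialTrace (Fin.succEmb 2)` in the coordinates `pairConfig`.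
[cite: KullEtAl2024, §2.1 (the LTI condition)] -/
theorem traceLeft_submatrix_tripleConfig (ρ : Op (Fin 3) q) :
    traceLeft (ρ.submatrix (tripleConfig q) (tripleConfig q)) =
      (spinPartialTrace (Fin.succEmb 2) ρ).submatrix (pairConfig q) (pairConfig q) := by
  ext ⟨y, z⟩ ⟨y', z'⟩
  rw [traceLeft_apply, Matrix.submatrix_apply, spinPartialTrace_succEmb_apply]
  rfl

/-- **`tr_R ρ^{(3)}` with literal legs**: after reassociating to `(first × second) × third`, the bipartite
`traceRight` (trace over the last site) is `tr_R = spinPartialTrace Fin.castSuccEmb` in the coordinates `pairConfig`.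
[cite: KullEtAl2024, §2.1 (the LTI condition)] -/
theorem traceRight_submatrix_tripleConfig_prodAssoc (ρ : Op (Fin 3) q) :
    traceRight ((ρ.submatrix (tripleConfig q) (tripleConfig q)).submatrix
        (Equiv.prodAssoc (Fin q) (Fin q) (Fin q)) (Equiv.prodAssoc (Fin q) (Fin q) (Fin q))) =
      (spinPartialTrace Fin.castSuccEmb ρ).submatrix (pairConfig q) (pairConfig q) := by
  ext ⟨x, y⟩ ⟨x', y'⟩
  rw [traceRight_apply, Matrix.submatrix_apply, spinPartialTrace_castSuccEmb_apply]
  refine Finset.sum_congr rfl fun z _ => ?_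
  simp only [Matrix.submatrix_apply, Equiv.prodAssoc_apply, tripleConfig_apply_eq_snoc]

/-- **The LTI row of `ρ^{(3)}` in product coordinates**: if `tr_L ρ = tr_R ρ` (window marginal of a
translation-invariant state, `spinPartialTrace_succ_densityAlong_eq_of_invariant`), then in the coordinates
`tripleConfig` the bipartite traces agree: `traceLeft ρ₃ = traceRight (ρ₃ reassociated)`.
[cite: KullEtAl2024, §2.1 (the LTI condition)] -/
theorem traceLeft_submatrix_tripleConfig_eq_traceRight_of_lti (ρ : Op (Fin 3) q)
    (h : spinPartialTrace (Fin.succEmb 2) ρ = spinPartialTrace Fin.castSuccEmb ρ) :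
    traceLeft (ρ.submatrix (tripleConfig q) (tripleConfig q)) =
      traceRight ((ρ.submatrix (tripleConfig q) (tripleConfig q)).submatrix
        (Equiv.prodAssoc (Fin q) (Fin q) (Fin q)) (Equiv.prodAssoc (Fin q) (Fin q) (Fin q))) := by
  rw [traceLeft_submatrix_tripleConfig, traceRight_submatrix_tripleConfig_prodAssoc, h]

/-- Positive semidefiniteness of `ρ^{(3)}` is the same in either coordinate system. [cite: KullEtAl2024, §2.2] -/
theorem posSemidef_submatrix_tripleConfig_iff (ρ : Op (Fin 3) q) :
    (ρ.submatrix (tripleConfig q) (tripleConfig q)).PosSemidef ↔ ρ.PosSemidef :=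
  Matrix.posSemidef_submatrix_equiv (tripleConfig q)

/-- Positive semidefiniteness of `ρ^{(2)}` is the same in either coordinate system. [cite: KullEtAl2024, §2.2] -/
theorem posSemidef_submatrix_pairConfig_iff (ρ : Op (Fin 2) q) :
    (ρ.submatrix (pairConfig q) (pairConfig q)).PosSemidef ↔ ρ.PosSemidef :=
  Matrix.posSemidef_submatrix_equiv (pairConfig q)

/-- The trace is unchanged by reindexing rows and columns along the same equivalence (any coefficients).
[cite: NielsenChuang2010, §2.4.3] -/
theorem trace_submatrix_equiv_equiv {R l m : Type*} [Fintype l] [Fintype m] [AddCommMonoid R]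
    (A : Matrix m m R) (e : l ≃ m) : (A.submatrix e e).trace = A.trace := by
  simp only [Matrix.trace, Matrix.diag_apply, Matrix.submatrix_apply]
  exact e.sum_comp (fun i => A i i)

/-! ### Coherence of the window splittings (first × rest, rest × last, first × middle × last) -/

/-- Reassociating the three-way split `first × (middle × last)` to `(first × middle) × last` is the two-way split
(rest × last) after gluing `first × middle` by `Fin.consEquiv`: entrywise
`Fin.cons x (Fin.snoc s z) = Fin.snoc (Fin.cons x s) z`. This is the reindexing used when the row
`(L ⊗ 𝟙) ω_{m-1} (L ⊗ 𝟙)ᴴ = tr_L ω_m` is checked on the true marginals. [cite: KullEtAl2024, §2.4–2.5 (eq. relaxLocTIn)] -/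
theorem submatrix_windowSplit3_prodAssoc (ρ : Op (Fin (n + 2)) q) :
    (ρ.submatrix (windowSplit3 n q) (windowSplit3 n q)).submatrix (Equiv.prodAssoc _ _ _) (Equiv.prodAssoc _ _ _) =
      (ρ.submatrix ((Equiv.prodComm _ _).trans (Fin.snocEquiv fun _ => Fin q))
          ((Equiv.prodComm _ _).trans (Fin.snocEquiv fun _ => Fin q))).submatrix
        (Equiv.prodCongr (Fin.consEquiv fun _ => Fin q) (Equiv.refl (Fin q)))
        (Equiv.prodCongr (Fin.consEquiv fun _ => Fin q) (Equiv.refl (Fin q))) := by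
  ext ⟨⟨x, s⟩, z⟩ ⟨⟨x', s'⟩, z'⟩
  simp only [Matrix.submatrix_apply, Equiv.prodAssoc_apply, windowSplit3_apply, Fin.cons_snoc_eq_snoc_cons]
  rfl

/-- The three-way split IS the two-way split (first × rest) after gluing `middle × last` by `Fin.snocEquiv`
(definitional). [cite: KullEtAl2024, §2.4–2.5 (eq. relaxLocTIn)] -/
theorem submatrix_windowSplit3_eq (ρ : Op (Fin (n + 2)) q) :
    ρ.submatrix (windowSplit3 n q) (windowSplit3 n q) =
      (ρ.submatrix (Fin.consEquiv fun _ => Fin q) (Fin.consEquiv fun _ => Fin q)).submatrix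
        (Equiv.prodCongr (Equiv.refl (Fin q)) ((Equiv.prodComm _ _).trans (Fin.snocEquiv fun _ => Fin q)))
        (Equiv.prodCongr (Equiv.refl (Fin q)) ((Equiv.prodComm _ _).trans (Fin.snocEquiv fun _ => Fin q))) := rfl

/-- `tripleConfig` is `windowSplit3 1` after identifying the middle leg `Fin 1 → Fin q` with `Fin q`
(`Equiv.funUnique`): `![a, b, c] = Fin.cons a (Fin.snoc (fun _ => b) c)`. [cite: KullEtAl2024, §2.3] -/
theorem tripleConfig_apply_eq_windowSplit3 (a b c : Fin q) :
    tripleConfig q (a, (b, c)) = windowSplit3 1 q (a, (fun _ : Fin 1 => b, c)) := by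
  rw [tripleConfig_apply_eq_cons, pairConfig_apply_eq_snoc, windowSplit3_apply]

end SmallWindows

end Literature.MathematicalPhysics.QuantumLattice
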